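import Mathlib
import HarnessLib
import HarnessLib.Audit
import Summits.HubbardSuperconductivity.Statement
import Literature.MathematicalPhysics.QuantumLattice.FockFirstQuantization
import HarnessLib.Audit.Status.Attr

/-!
Route: SignStructure

DORMANT since 2026-08-22T13:14:40Z (reconciler: no traction for 5.3 d (last activity item-evidence-added at 2026-08-17T04:09:59Z); parked, not closed — `ledger route dormant route-HubbardSuperconductivity-SignStructure --off` to reactiv) — unstaffed, not closed; items shared with open routes are served there. `ledger route dormant <id> --off` reactivates.

Route SignStructure — HubbardSuperconductivity/HubbardSuperconductivity (plancards window
2026-08-15; card realised: HubbardSuperconductivity/HubbardSuperconductivity/sign-structure-odlro,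
novelty audit: new-combination).
NEGATIVE SIDE, WITNESS-CLASS EXCLUSION — the state-space dual of route NoGo. TARGET X = ¬S pushed
through the quantifiers in the AUDITED typing: for every U > 0 and every δ ∈ (0,1/2) there are N, ψ
satisfying the summit's hypotheses (N_L = 2⌊(1−δ)L²/2⌋, ψ_L a normalised (N_L, S^z = 0)-sector
ground state of hubbardTorus 2 L 1 U at every even L) WITHOUT even-side d_{x²−y²} pair-field
long-range order. Assembly: Target → ¬HubbardSuperconductivity (pure logic; an `example` proving it
is rc0 in the planner's sketch). One-line Lean form of X = the decl `Target` of this file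
(elaborates; constants Literature.MathematicalPhysics.QuantumLattice.{Fock, Orb, FermionTorus,
IsGroundStateInSector, hubbardTorus, torusPullback, pairFieldCorr, dWaveFormFactor},
Literature.Probability.LatticeModels.{HasLongRangeOrder, halfOpenBox}). NoGo's NogoThesis is the
same statement in pre-audit typing (U ≠ 0, δ < 1, all L); once restated the two targets should be
one shared decl with two decompositions.
THE LINE. NoGo decomposes ¬S by REGIONS of the (U,δ) plane; this route decomposes it by CLASSES OF
STATES that can never witness S: a ground-state sequence whose d-wave pair correlator is that of an
excluded-class sequence has no d-wave LRO. The catalogued barrier GeneralizedHartreeFockNoPairing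
(Bach–Lieb–Solovej Thm 2.11) excludes the quasi-free class as ENERGY minimisers; the card 'ODLRO
lives in the sign structure' excludes STATES regardless of energy and pushes the class outward by
two provable steps and one conjecture, all typed here over the tree's concrete Fock space (Fock ι =
Finset ι → ℂ: a positive Jastrow reweighting is a diagonal matrix, a Slater determinant is
FirstQuant.slater of product orbitals):
 • crux (rank 2) JastrowSlaterNoDWaveLRO — for every FIXED strictly positive, finite-range,
translation-invariant weight (product over sites x of g(occupation pattern of the configuration in
the r-box around x, both spins); g > 0 arbitrary, so Gutzwiller and density/spin Jastrow factors of
any strength) and EVERY sequence of Slater determinants Φ_L (any orbitals, any filling), the states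
JΦ_L/‖JΦ_L‖ have L⁻⁴⟨Δ_d†Δ_d⟩ → 0. No Jastrow–Slater d-wave condensate.
 • crux (rank 3) SlaterSquaredDoublonODLRO — the CONVERSE in the s-channel, calibrating crux 2:
det[φ(X)]² ≥ 0, so the doublon-favouring (g_D → ∞) limit of a spin-balanced Slater determinant is a
hard-core DOUBLON Bose state with amplitudes det(K_XX) ≥ 0 (K a translation-invariant real projector
— the Fermi-disc projector is the intended witness); claim: some such sequence at pair density ρ ∈
(0,1/2) has ON-SITE pair ODLRO, liminf L⁻⁴⟨Δ_s†Δ_s⟩/‖Ψ‖² > 0. Motrunich–Fisher's VMC sees exactly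
this for the '(det)² S-type' state (n_{k=0}/N ≈ 0.10, 0.083 in the continuum; 'unambiguously ODLRO
on a lattice'). Consequences: the card's original wording ('no pair ODLRO for EVERY finite-range g,
arbitrarily strong J') is very likely false in the s-channel; any proof of crux 2 must use the
d_{x²−y²} form factor, i.e. the X ≠ Y sign structure of det[φ(X)]det[φ(Y)]; and the statement is the
trial-state shadow of NoGo's U < 0 leg (the U → −∞ ground state is a positive doublon wavefunction).
 • support DressedSlaterNoPairLRO (provable now): for any Slater determinant and any
number-conserving unitary W whose conjugated local pair operators W†P_xW stay r-local,
L⁻⁴⟨Δ_d†Δ_d⟩_{WΦ} ≤ C(r)/L² → 0 (Wick + charge counting: ≥ 2 contractions cross between the balls;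
Σ_b |G(a,b)|² ≤ G(a,a) ≤ 1 for a projector — no clustering of Φ needed, sharper than
Bravyi–Hastings–Verstraete for this purpose): d-wave LRO at side L forces dressing range ≳ L^{1/2}.
• support SlaterRankBound (provable now): v†ρ₂(Σ_a α_aΦ_a)v ≤ 2(Σ_a |α_a|‖Φ_a‖)²‖v‖² — Yang ODLRO λ
≥ cN needs Slater rank ≥ cN/2. • support StripeWindowMembership: the bridge 'crux 2 → Target
restricted to U ∈ [6,8], δ ∈ [1/10,1/6]' (content: some GS sequence there is
pair-correlator-equivalent to a fixed-weight Jastrow × UHF-stripe Slater sequence; numerics-anchored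
and tool-less exactly like NoGo's NogoStripeWindow, which is its consequent). • crux (rank 4; added
2026-08-16 at the operator's route-choice on the target-unreachable hold) JastrowSlaterShadow — the
MEMBERSHIP BET filed globally: for every U > 0 and δ ∈ (0,1/2) some admissible ground-state sequence
ψ_L is d-wave-pair-FUNCTIONAL-equivalent to ONE fixed-weight Jastrow–Slater sequence χ_L of exactly
crux 2's class (same r, g, filling and orbital data as there): F_d(ψ_{L+1}) − F_d(χ_{L+1}) → 0,
F_d(·) = Re⟨·, Δ_d†Δ_d ·⟩/(‖·‖² L⁴). • support ShadowTransfer (the glue; PROVED sorry-free in the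
planner's SketchProof.lean, to be ported into Theorems/): JastrowSlaterNoDWaveLRO →
JastrowSlaterShadow → Target — crux 2 at the shadow's data gives F_d(χ_L) → 0, hence F_d(ψ_L) → 0,
and along even sides 2k the summit's LRO sequence IS F_d(ψ_{2k}) (torusLROSeq_pairFieldCorr_succ,
‖ψ_{2k}‖ = 1), so its liminf is 0. This is the chain by which the cruxes reach the Target.
TWO-LAYER PLAN (D-0019). Layer 1 = the two cruxes. Layer 2, at the first split of
JastrowSlaterNoDWaveLRO: (i) weak-Jastrow regime |log g| ≤ ε(r) for ALL Φ_L (fermionic cluster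
expansion with Gram bounds; obstacle: the equal-time propagator of a 2D Fermi sea decays like
r^{−3/2}, not summable, so determinant structure — not absolute convergence — must carry the proof);
(ii) gapped Φ_L with exponentially decaying G (polymer expansion, provable); (iii) the
full-projection corner at n = 1 (no carriers, no LRO) and its lightly doped neighbourhood (the
Affleck–Zou–Hsu–Anderson danger zone). CANDOUR: the exclusion cruxes reach the Target only through
the membership step, filed since 2026-08-16 as the rank-4 crux JastrowSlaterShadow with the proved
glue ShadowTransfer (regional instance: StripeWindowMembership). Because crux 2's class contains
d-wave-inert members (g ≡ 1 and the free Fermi sea, F_d = O(L⁻²) by Wick; even the empty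
determinant), JastrowSlaterShadow is logically EQUIVALENT to the lim-form of Target ('some
admissible sequence has F_d(ψ_L) → 0 along even sides'): the Jastrow–Slater class is the REASON to
expect it — wherever VMC/DMRG see no superconductivity, optimised Jastrow–Slater liquids or
UHF-stripe determinants reproduce the ground state's pairing correlations — not a weakening of it.
Like NoGo's uncovered regions it is consensus-false at weak coupling (Kohn–Luttinger d-wave) and
tool-less elsewhere; provers do not attempt it, refuters attach evidence. Value of the route: (a)
permanent typed constraints on every S-side construction (PlaquetteBoson / RVB / BCS anchors must
land outside these classes, quantitatively); (b) two genuinely open, cheaply refutable statements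
where either answer is publishable; (c) the Wick/Slater infrastructure in Theorems/ that the
supports force.
Lean: `∀ U : ℝ, 0 < U → ∀ δ ∈ Set.Ioo (0:ℝ) (1/2), ∃ (N : ℕ → ℕ) (ψ : ∀ L,
Literature.MathematicalPhysics.QuantumLattice.Fock
(Literature.MathematicalPhysics.QuantumLattice.Orb
(Literature.MathematicalPhysics.QuantumLattice.FermionTorus 2 L))), (∀ L, Even L → N L = 2 * ⌊(1 -
δ) * (L : ℝ) ^ 2 / 2⌋₊ ∧ star (ψ L) ⬝ᵥ ψ L = 1 ∧
Literature.MathematicalPhysics.QuantumLattice.IsGroundStateInSector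
(Literature.MathematicalPhysics.QuantumLattice.hubbardTorus 2 L 1 U) (N L) 0 (ψ L)) ∧ ¬
Literature.Probability.LatticeModels.HasLongRangeOrder (fun k =>
Literature.Probability.LatticeModels.halfOpenBox 2 (2 * k)) (fun k =>
Literature.MathematicalPhysics.QuantumLattice.torusPullback
(Literature.MathematicalPhysics.QuantumLattice.pairFieldCorr
Literature.MathematicalPhysics.QuantumLattice.dWaveFormFactor ψ) (2 * k))` (= the decl Target; the
chain is JastrowSlaterNoDWaveLRO → JastrowSlaterShadow → Target → ¬HubbardSuperconductivity, the
last arrow being `closes`).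

Rationale: WHY THIS LINE. The only catalogued no-pairing theorem for the repulsive model (BachLiebSolovej1994
Thm 2.11 = Literature.Barriers.HubbardSuperconductivity.GeneralizedHartreeFockNoPairing) speaks
about quasi-free ENERGY minimisers. The card asks the kinematic question instead — how far from a
Slater determinant must ANY d-wave condensate be — and answers: outside every finite-depth
number-conserving dressing (DressedSlaterNoPairLRO, provable: Wick + projector identity), of Slater
rank ≥ cN (SlaterRankBound, provable: Yang1962/Coleman1965 interpolation), and — conjecturally —
outside every positive finite-range Jastrow reweighting (JastrowSlaterNoDWaveLRO). The planner's
check of that conjecture against det² ≥ 0 produced the converse crux SlaterSquaredDoublonODLRO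
(MotrunichFisher2007 §4.1.1: the '(det)²' boson state condenses numerically), which fixes the
channel (d-wave only) and the mechanism (X ≠ Y sign structure) of any proof. Imported areas:
quantum-information locality (BravyiHastingsVerstraete2006, HastingsWen2005), reduced-density-matrix
theory (Yang1962, Coleman1965), VMC/RVB wavefunction lore made into statements (Gros1989,
ZhangGrosRiceShiba1988, AffleckZouHsuAnderson1988, ParamekantiRanderiaTrivedi2001, CapelloEtAl2005,
LeeNagaosaWen2006), Bose-liquid wavefunctions (MotrunichFisher2007, McMillan1965,
ReattoChester1967), constructive fermionic expansions for layer 2. Catalogue entries used: physical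
analogy WITH dictionary (doublon = hard-core boson, amplitude det(K_XX)); VMC/certified computation
as refutation tool only.
RANKED CRUXES. 2 JastrowSlaterNoDWaveLRO — the conjecture; hardest and most informative; FASTEST
REFUTATION: VMC (kit) on L ≤ 24 tori, optimise a density/spin Jastrow (incl. doublon- and
singlet-bond-favouring patterns, r ≤ 3) on (a) the free Fermi sea, (b) lightly doped staggered-flux
/ d-density-wave Slater determinants, δ = 0.05–0.4, track L⁻⁴⟨Δ_d†Δ_d⟩ vs L; any non-decaying signal
refutes (and is itself news). 3 SlaterSquaredDoublonODLRO — the s-channel converse; FASTEST TEST: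
sign-free VMC of G_b(r) for Ψ = det(K_XX), K = lattice Fermi-disc projector, pair density 0.1–0.45,
L ≤ 40, finite-size scaling of n_{k=0}/n. 4 JastrowSlaterShadow (added 2026-08-16, route-choice
repair of the target-unreachable hold) — the membership bet, global: at every (U,δ) some admissible
ground-state sequence is F_d-shadowed (difference → 0) by one fixed-weight Jastrow–Slater sequence
of crux 2's class; equivalent to the lim-form of Target because the class has d-inert members;
ranked last because it is the least workable, not the least doubtful (why it might fail:
consensus-false at weak coupling, RaghuKivelsonScalapino2010 / ArovasBergKivelsonRaghu2022 §9; its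
negation at one (U,δ) is a pairing theorem, so it is irrefutable short of S); it enters `closes`
through the support ShadowTransfer = JastrowSlaterNoDWaveLRO → JastrowSlaterShadow → Target (proved
in the planner's SketchProof.lean, rc 0, no sorry).
KILL CRITERIA. (i) Crux 2 refuted by an explicit (g, Φ_L) with a certified non-decaying d-wave
signal → restate once on the surviving sub-class (spin-independent density Jastrow, or Φ_L = free
Fermi sea), else close `refuted:JastrowSlaterNoDWaveLRO` keeping the supports as Literature targets.
(ii) WeakCouplingBCS cruxes 2+4 proved (d-wave LRO for every sector GS at small U) → Target false →
close (supports survive as theorems). (iii) Crux 3 refuted (no translation-invariant projector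
sequence condenses) → informative, not fatal: restate the calibration as its negation (the s-channel
no-go is then back). (iv) JastrowSlaterShadow can only die together with Target (a theorem 'limsup_L
F_d(ψ_L) > 0 for every admissible sequence' at some (U,δ), e.g. WeakCouplingBCS closing): then close
the route refuted:JastrowSlaterShadow; cruxes 2–3 and the supports survive as free-standing
witness-class statements.
NOT DECOMPOSED YET (deliberately): any REGIONAL decomposition of JastrowSlaterShadow beyond the
stripe window (no tool; consensus-false at weak coupling — the global item exists only to make the
chain cruxes → Target explicit, D-0027 §2.1); the card's Borchardt det×perm class (S4: constructive,
chiral d+id, belongs to the chiral-window cards, not to ¬S); fixed-node / sign-cone versions of the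
slogan (checked and DROPPED: the cone {DΦ : D ≥ 0 diagonal} of any Slater Φ contains d-wave
condensates trivially — restrict P_N|dBCS⟩ to its sign-agreement set with Φ, fidelity ≈ 0.7 — and
L⁻⁴⟨Δ_d†Δ_d⟩ is ℓ²-Lipschitz with an L-uniform constant since ‖Δ_d‖ ≤ CL², so no cone statement
survives; LOCALITY of the reweighting is what makes crux 2 non-trivial); Pfaffian/AGP references (on
the permitted side by construction).
CHEAPEST FALSIFIER. For the line: the fixed-g VMC scan queued by the crux-attack refuter on crux 2
(kit jobs j004611–j004620: bond-doublon Jastrow of strength γ = 1/g on FS↑⊗FS↓, L = 8…32) — a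
non-decaying L⁻⁴⟨Δ_d†Δ_d⟩ at FIXED g refutes JastrowSlaterNoDWaveLRO and breaks the chain at its
first link (Yokoyama2002 App. B predicts decay at every fixed γ > 0). JastrowSlaterShadow has no
cheap falsifier (its negation is a pairing theorem); ShadowTransfer none (proved).
NOVELTY (full text in the Novelty field): nearest prior art BachLiebSolovej1994 (quasi-free,
energy), BravyiHastingsVerstraete2006/HastingsWen2005 (finite depth, needs clustering),
Yang1962/Coleman1965 (λ_max kinematics), Gros1989/CapelloEtAl2005/ParamekantiRanderiaTrivedi2001
(VMC lore), MotrunichFisher2007 ((det)² condenses); delta = the typed fixed-weight Jastrow–Slater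
no-d-wave-ODLRO conjecture + the det² ⇒ doublon-condensate converse that pins channel and mechanism
+ the clustering-free finite-depth lemma; expected grade new-combination.
BARRIERS (full text in the Barriers field): extends GeneralizedHartreeFockNoPairing within its
scope_caveats (states not energies; larger class); LROForcesLowLyingStates n/a (fixed-N kinematics);
SignProblemNPHard thematic only (crux 3's state is positive ⇒ sign-free numerics; VMC is a
refutation tool, never a certificate); Weak/Strong-coupling ceilings and PerturbativeInvisibility
not engaged (no expansion in U); PureModelStripeCompetition = the evidence behind
StripeWindowMembership. Honest limit: nothing here bounds the TRUE ground state's functional; the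
membership step is the bet — filed globally as the crux JastrowSlaterShadow (equivalent to the
lim-form of Target) and regionally as StripeWindowMembership.

Novelty: Searched (card's audited searches + this session): `lit read arxiv:cond-mat/0703261`
(MotrunichFisher2007, held; chunk p14 §4.1.1 'S-type state Ψ = (det)² has off-diagonal long-range
order … n_{k=0}/N = 0.10 and 0.083 … cannot rule out that the Green's function vanishes …
unambiguously ODLRO when studied on a lattice'; p34 '(det)² wavefunction is positive … has ODLRO');
`lit search --hybrid 'SU(2) gauge symmetry large-U Hubbard flux d-wave half filling'` (→
book:xiang2022-d-wave-superconductivity p60 eq. (2.4) local SU(2); AffleckZouHsuAnderson1988,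
ZhangGrosRiceShiba1988, Gros1989 in references.bib); `lit galaxy search 'd-wave correlated critical
Bose liquids' --star all` (1 row: arXiv:2405.13405, d-wave Cooper-pair Bose metal 2024 — DBL physics
alive, no theorem); `lit galaxy search 'product of two Slater determinants' --star pdf` (7 rows,
none relevant); barrier catalogue read (GeneralizedHartreeFockNoPairing incl. audit parts 1–3);
OpenAlex/S2/arXiv remote APIs rate-limited (HTTP 429) throughout the session, so the VMC/fixed-node
literature on pairing in Jastrow–Slater states (Sorella–Becca lattice fixed-node;
Eichenberger–Baeriswyl; Yokoyama–Ogata) is cited from memory and should be re-checked by the novelty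
audit. NEAREST PRIOR ART: BachLiebSolovej1994 Thm 2.11 (arXiv:cond-mat/9312044; catalogued barrier:
quasi-free ENERGY minimisers never pair) — the class being enlarged, and from energies to states;
BravyiHastingsVerstraete2006 (doi:10.1103/PhysRevLett.97.050401) + Ha  [refs: 10.1103/PhysRevLett.97.050401, cond-mat/0703261, 2405.13405, cond-mat/9312044, arxiv:cond-mat/0703261, book:xiang2022-d-wave-superconductivity, doi:10.1103/PhysRevLett.97.050401, MotrunichFisher2007, AffleckZouHsuAnderson1988, ZhangGrosRiceShiba1988, Gros1989, BachLiebSolovej1994, BravyiHastingsVerstraete2006, HastingsWen2005, Yang1962, YangODLRO1962, Coleman1965, ParamekantiRanderiaTrivedi2001, C]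

Barriers (technique_class: wavefunction sign-structure; variational witness-class no-go): - Literature.Barriers.HubbardSuperconductivity.GeneralizedHartreeFockNoPairing: EXTENDED, not evaded
— same moral (repulsion does not pair at mean-field level) carried from quasi-free ENERGY minimisers
(BLS Thm 2.11, proved in tree) to STATES regardless of energy and to larger classes: finite-depth
number-conserving dressings of Slater determinants (DressedSlaterNoPairLRO, provable), coherent
superpositions of < cN/2 determinants (SlaterRankBound, provable), positive finite-range Jastrow
reweightings (JastrowSlaterNoDWaveLRO, conjectured, d-channel only — the s-channel converse
SlaterSquaredDoublonODLRO marks the edge). Consistent with the entry's scope_caveats (which name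
only Hainzl–Hamza–Seiringer–Solovej-type extensions).
- Literature.Barriers.HubbardSuperconductivity.LROForcesLowLyingStates: not applicable — every
statement is fixed-N, finite-volume, kinematic (properties of explicit pure states); no
uniqueness/gap/symmetry argument is used to deny LRO.
- Literature.Barriers.HubbardSuperconductivity.SignProblemNPHard: thematically adjacent ('sign
structure') but logically untouched — no sampling certificate is proposed; VMC enters only as the
refuters' tool for cruxes 2–3, and crux 3's wavefunction det(K_XX) ≥ 0 is sign-FREE, so its numerics
are unbiased.
- Literature.Barriers.HubbardSuperconductivity.WeakCouplingCeiling and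
Literature.Barriers.HubbardSuperconductivity.PerturbativeInvisibilityOfPairing: not engaged (no
expansion in U anywhere); they bite only on the unfi

History (route lifecycle, newest last):
- 2026-08-16T04:07:14Z · AUTO-CRUX (backfill): Target — hypotheses of the deciding theorem that nothing in the route derives are cruxes (operator:999:1085951)
- 2026-08-22T13:14:40Z · DORMANT — reconciler: no traction for 5.3 d (last activity item-evidence-added at 2026-08-17T04:09:59Z); parked, not closed — `ledger route dormant route-HubbardSupercond (operator:999:4147796)

sub-problem: HubbardSuperconductivity · status: dormant · opened planner-plancard-HubbardSuperconductivity-Hub-3c3ad7f0-0 2026-08-15T11:01:17Z · rev 3 · ledger route-HubbardSuperconductivity-SignStructure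
GENERATED by the gate from the ledger (D-0016/17). Provers cite these decls: `theorem foo : Summit.HubbardSuperconductivity.HubbardSuperconductivity.Theses.SignStructure.<Decl> := …` in Summits/HubbardSuperconductivity/HubbardSuperconductivity/Theorems/<Name>.lean.
-/

namespace Summit.HubbardSuperconductivity.HubbardSuperconductivity.Theses.SignStructure

open scoped BigOperators Topology Manifold Classical MeasureTheory ProbabilityTheory Matrix InnerProductSpace ComplexConjugate ContinuousMap
open Filter Set Function TopologicalSpace MeasureTheory

attribute [summit_statement] _root_.HubbardSuperconductivity

open Literature.Hubbard

/-- item stmt-HubbardSuperconductivity-2136 · crux (kind.auto-crux: conjecture-grade) · rank 0 · open · by planner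
why it might fail: Consensus FALSE at weak coupling: Kohn–Luttinger/perturbative RG give a d_{x²−y²} GS for 0<U≪t, 0.6<n<1, t'=0 (RaghuKivelsonScalapino2010; ABKR2022 §9) ⇒ LRO for every GS sequence there. Target ↔ ¬S is PROVED (NoGo.not_hubbardSuperconductivity_iff): irrefutable short of settling S.
sources: RaghuKivelsonScalapino2010, ArovasBergKivelsonRaghu2022, KohnLuttinger1965, QinEtAl2020, Scalapino1995
[target] ¬HubbardSuperconductivity pushed through the quantifiers in the AUDITED typing (0 < U, δ ∈
Ioo 0 (1/2), Even-L hypotheses, ¬ even-side HasLongRangeOrder of torusPullback (pairFieldCorr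
dWaveFormFactor ψ)). Same mathematical statement as NoGo.NogoThesis
(stmt-HubbardSuperconductivity-0167, typed pre-audit with U ≠ 0, δ < 1, all L; grounder note
2026-08-14 asks for exactly this retyping); when NoGo restates, merge (one decl, two decompositions:
NoGo by (U,δ)-regions, this route by witness classes). Physics prior: FALSE at weak coupling. ||
Sources: RaghuKivelsonScalapino2010, ArovasBergKivelsonRaghu2022, Scalapino1995. -/
@[route_item "route-HubbardSuperconductivity-SignStructure", crux]
def Target : Prop :=
  ∀ U : ℝ, 0 < U → ∀ δ ∈ Set.Ioo (0:ℝ) (1/2), ∃ (N : ℕ → ℕ) (ψ : ∀ L, Literature.MathematicalPhysics.QuantumLattice.Fock (Literature.MathematicalPhysics.QuantumLattice.Orb (Literature.MathematicalPhysics.QuantumLattice.FermionTorus 2 L))), (∀ L, Even L → N L = 2 * ⌊(1 - δ) * (L : ℝ) ^ 2 / 2⌋₊ ∧ star (ψ L) ⬝ᵥ ψ L = 1 ∧ Literature.MathematicalPhysics.QuantumLattice.IsGroundStateInSector (Literature.MathematicalPhysics.QuantumLattice.hubbardTorus 2 L 1 U) (N L) 0 (ψ L)) ∧ ¬ Literature.Probability.LatticeModels.HasLongRangeOrder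 (fun k => Literature.Probability.LatticeModels.halfOpenBox 2 (2 * k)) (fun k => Literature.MathematicalPhysics.QuantumLattice.torusPullback (Literature.MathematicalPhysics.QuantumLattice.pairFieldCorr Literature.MathematicalPhysics.QuantumLattice.dWaveFormFactor ψ) (2 * k))

/-- item stmt-HubbardSuperconductivity-2137 · crux · rank 2 · open · by planner
why it might fail: g is spin-resolved: the r=1 weight locking (x,↓)⇔(x−e1,↑) on FS↑⊗FS↓ is the ↓-shift image of the attractive Gutzwiller state, Δ_d ↦ f(e1)Δ_onsite+defects, so d-LRO ⇔ pair LRO of fixed-γ GWF: yes at γ=0 per MF2007 p16 (det² condensate), but P(0) finite at each fixed γ>0 in Yokoyama2002 App.B (L≤20).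
sources: MotrunichFisher2007, arXiv:cond-mat/0703261, Yokoyama2002, arXiv:cond-mat/0205281, McMillan1965, AffleckZouHsuAnderson1988
[crux] NO JASTROW–SLATER d-WAVE CONDENSATE (card S3, channel-corrected). Data: range r; a FIXED
(L-independent) local weight g : Finset (Site 2 × Fin 2) → ℝ, g > 0, read on the occupation pattern
{(e,σ) : e ∈ box 2 r, orbital (x+e,σ) occupied} around each site x; Jastrow weight w(s) = ∏_x
g(pattern_x(s)) (covers Gutzwiller g_D^{#doublons}, density and spin Jastrow e^{−Σ v(x−y) n_x n_y}
of range ≤ 2r, many-body local factors; ANY strength, since g is arbitrary but fixed); Slater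
determinants Φ_L = FirstQuant.slater(∏_k φ_L k (o k)) = c†(φ₀)…c†(φ_{N−1})|0⟩ with arbitrary (not
necessarily orthonormal, possibly spin-mixed) orbitals and arbitrary filling N_L. CLAIM: for χ_L =
w·Φ_L (diagonal action), ⟨χ, Δ_d†Δ_d χ⟩/(‖χ‖² L⁴) → 0 along ALL L (0/0 = 0 when χ = 0). WHY IT IS
MATHEMATICS: for positive-definite v the Hubbard–Stratonovich identity makes JΦ an average of
gauge-rotated Slater determinants and ⟨P_x†P_y⟩ a double average of Löwdin transition densities
det(overlap)·G̃G̃ with possibly long-ranged near-singular overlaps; the weak-g cumulant expansion is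
NOT uniformly convergent for a metallic Φ (|G(r)| ~ r^{−3/2} in 2D is not summable; order-n tree
bounds grow like L^{n/2}), so canc -/
@[route_item "route-HubbardSuperconductivity-SignStructure"]
def JastrowSlaterNoDWaveLRO : Prop :=
  ∀ (r : ℕ) (g : Finset (Literature.Probability.LatticeModels.Site 2 × Fin 2) → ℝ), (∀ X, 0 < g X) → ∀ (N : ℕ → ℕ) (φ : ∀ L, Fin (N L) → Literature.MathematicalPhysics.QuantumLattice.Orb (Literature.MathematicalPhysics.QuantumLattice.FermionTorus 2 L) → ℂ), Filter.Tendsto (fun L : ℕ => let χ : Literature.MathematicalPhysics.QuantumLattice.Fock (Literature.MathematicalPhysics.QuantumLattice.Orb (Literature.MathematicalPhysics.QuantumLattice.FermionTorus 2 (L + 1))) := fun s => (((fun s : Finset (Literature.MathematicalPhysics.QuantumLattice.Orb (Literature.MathematicalPhysics.QuantumLattice.FermionTorus 2 (L + 1))) => ∏ x : Literature.Probability.LatticeModels.TorusSite 2 (L + 1), g ((Literature.Probability.LatticeModels.box 2 r ×ˢ (Finset.univ : Finset (Fin 2))).filter (fun p => Literature.MathematicalPhysics.QuantumLattice.orb (Literature.MathematicalPhysics.QuantumLattice.FermionTorus.ofTorusSite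 (x + Literature.Probability.LatticeModels.Torus.proj (L + 1) p.1)) p.2 ∈ s))) s : ℝ) : ℂ) * Literature.MathematicalPhysics.QuantumLattice.FirstQuant.slater (fun o : Fin (N (L + 1)) → Literature.MathematicalPhysics.QuantumLattice.Orb (Literature.MathematicalPhysics.QuantumLattice.FermionTorus 2 (L + 1)) => ∏ k, φ (L + 1) k (o k)) s; (Literature.MathematicalPhysics.QuantumLattice.expect ((Literature.MathematicalPhysics.QuantumLattice.pairField Literature.MathematicalPhysics.QuantumLattice.dWaveFormFactor (L + 1))ᴴ * Literature.MathematicalPhysics.QuantumLattice.pairField Literature.MathematicalPhysics.QuantumLattice.dWaveFormFactor (L + 1)) χ).re / ((star χ ⬝ᵥ χ).re * (((L + 1) : ℕ) : ℝ) ^ 4)) Filter.atTop (nhds 0)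

/-- item stmt-HubbardSuperconductivity-2138 · crux · rank 3 · open · by planner
why it might fail: Numerics conflict: MF2007 p16 'lattice ODLRO by finite-size scaling' (no data; continuum p14 n₀/N 0.10→0.083 as N 161→325) vs Yokoyama2002 App.B: γ→0 Gutzwiller state = this det² doublon gas (n=1,½; L≤20): P(0) diverges yet 'no singlet LRO even in this limit'. No rigorous 2D BEC tool for det(K_XX)².
sources: MotrunichFisher2007, arXiv:cond-mat/0703261, Yokoyama2002, arXiv:cond-mat/0205281, ReattoChester1967, PenroseOnsager1956
[crux] THE s-CHANNEL CONVERSE (planner's calibration of crux 2; either answer valuable). det[φ(X)]²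
≥ 0 for real (or ±k-closed-shell) orbitals, and equals det(K_XX) for the projector K onto their
span; so the doublon-favouring limit (Gutzwiller g_D → ∞) of a spin-balanced same-orbital Slater
determinant is the hard-core DOUBLON state Ψ(s) = [s fully paired, n pairs]·det(K_{X,X}) ≥ 0, X =
doubly occupied sites — Motrunich–Fisher's 'S-type (det)²' Bose wavefunction. CLAIM (∃): some
sequence n_L, K_L (real symmetric idempotent, trace n_L, translation-invariant on (ℤ/(L+1)ℤ)²;
intended witness: the Fermi-disc projector with closed shells), pair density n_L/(L+1)² → ρ ∈
(0,1/2), has liminf ⟨Ψ, Δ_s†Δ_s Ψ⟩/(‖Ψ‖² (L+1)⁴) > 0 with Δ_s = pairField sWave = √2 Σ_x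
c_{x↑}c_{x↓} (on-site pair ODLRO = BEC of the doublons; all Jordan–Wigner signs are + because a
doublon is an adjacent orbital pair). EVIDENCE: MotrunichFisher2007 §4.1.1 (continuum N = 161, 325:
n_{k=0}/N = 0.10, 0.083; 'unambiguously ODLRO on a lattice at fixed boson density'), §8 ('the (det)²
wavefunction is positive … has ODLRO'); phonon heuristics (free-fermion S(k) ∝ |k| is phonon-like;
ReattoChester1967: T = 0 BEC survives 1/r -/
@[route_item "route-HubbardSuperconductivity-SignStructure"]
def SlaterSquaredDoublonODLRO : Prop :=
  ∃ (n : ℕ → ℕ) (K : ∀ L : ℕ, Matrix (Literature.Probability.LatticeModels.TorusSite 2 (L + 1)) (Literature.Probability.LatticeModels.TorusSite 2 (L + 1)) ℝ), (∃ ρ ∈ Set.Ioo (0:ℝ) (1/2), Filter.Tendsto (fun L : ℕ => (n L : ℝ) / (((L + 1) : ℕ) : ℝ) ^ 2) Filter.atTop (nhds ρ)) ∧ (∀ L, (K L).IsSymm ∧ K L * K L = K L ∧ (K L).trace = n L ∧ ∀ a x y : Literature.Probability.LatticeModels.TorusSite 2 (L + 1), K L (x + a) (y + a) = K L x y) ∧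 0 < Filter.liminf (fun L : ℕ => let Ψ : Literature.MathematicalPhysics.QuantumLattice.Fock (Literature.MathematicalPhysics.QuantumLattice.Orb (Literature.MathematicalPhysics.QuantumLattice.FermionTorus 2 (L + 1))) := fun s : Finset (Literature.MathematicalPhysics.QuantumLattice.Orb (Literature.MathematicalPhysics.QuantumLattice.FermionTorus 2 (L + 1))) => if (s.card = 2 * n L ∧ ∀ o ∈ s, Literature.MathematicalPhysics.QuantumLattice.orb (ofLex o).1 0 ∈ s ∧ Literature.MathematicalPhysics.QuantumLattice.orb (ofLex o).1 1 ∈ s) then ((Matrix.det ((K L).submatrix (fun i : {x : Literature.Probability.LatticeModels.TorusSite 2 (L + 1) // Literature.MathematicalPhysics.QuantumLattice.orb (Literature.MathematicalPhysics.QuantumLattice.FermionTorus.ofTorusSite x) 0 ∈ s} => (i : Literature.Probability.LatticeModels.TorusSite 2 (L + 1))) (fun i : {x : Literature.Probability.LatticeModels.TorusSite 2 (L + 1) // Literature.MathematicalPhysics.QuantumLattice.orb (Literature.MathematicalPhysics.QuantumLattice.FermionTorus.ofTorusSite x) 0 ∈ s} => (i : Literature.Probability.LatticeModels.TorusSite 2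 (L + 1)))) : ℝ) : ℂ) else 0; (Literature.MathematicalPhysics.QuantumLattice.expect ((Literature.MathematicalPhysics.QuantumLattice.pairField Literature.MathematicalPhysics.QuantumLattice.sWave (L + 1))ᴴ * Literature.MathematicalPhysics.QuantumLattice.pairField Literature.MathematicalPhysics.QuantumLattice.sWave (L + 1)) Ψ).re / ((star Ψ ⬝ᵥ Ψ).re * (((L + 1) : ℕ) : ℝ) ^ 4)) Filter.atTop

/-- item stmt-HubbardSuperconductivity-14442 · crux · rank 4 · open · by planner
why it might fail: Consensus FALSE at weak coupling: KL/RG d_{x²−y²} GS for 0<U≪t, 0.6<n<1 (RKS2010 pp.2,6; ABKR2022 §9) ⇒ limsup F_d>0 for every GS sequence there. Class contains the free Fermi sea ⇒ item ⟺ lim-form of Target: no proof short of settling ¬S.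
sources: RaghuKivelsonScalapino2010, ArovasBergKivelsonRaghu2022, QinEtAl2020, XuEtAl2024, ParamekantiRanderiaTrivedi2001, Gros1989
[crux] JASTROW–SLATER SHADOW — the membership bet, filed GLOBALLY (2026-08-16, operator route-choice
on the target-unreachable hold) so that the chain cruxes → Target is an explicit item (glue:
ShadowTransfer). For every U > 0 and δ ∈ (0,1/2) there are an admissible sequence (N_L =
2⌊(1−δ)L²/2⌋ and ψ_L a normalised (N_L, S^z = 0)-sector ground state of hubbardTorus 2 L 1 U at
every EVEN L; odd sides unconstrained, as in Target) and ONE fixed-weight Jastrow–Slater sequence χ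
in exactly the class of JastrowSlaterNoDWaveLRO (range r; fixed local weight g > 0 on occupation
patterns in box 2 r × Fin 2; any filling N′_L; any orbitals φ_L; χ_{L+1} = (∏_x g(pattern_x)) ·
FirstQuant.slater(∏_k φ_{L+1} k (o k)), the term copied verbatim from that crux) such that the
normalised d_{x²−y²} pair-field functionals F_d(·) = Re⟨·, Δ_d†Δ_d ·⟩/(Re⟨·,·⟩ · (L+1)⁴) satisfy
F_d(ψ_{L+1}) − F_d(χ_{L+1}) → 0 as L → ∞ (all L: at odd sides ψ is free, so this costs nothing).
PHYSICAL CONTENT: the VMC/DMRG worldview 'as far as pairing correlations go, the repulsive Hubbard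
ground state is a (Gutzwiller–)Jastrow–Slater liquid, flux or UHF-stripe state' (Gros1989,
ParamekantiRanderiaTrivedi2001, CapelloEtAl2005; -/
@[route_item "route-HubbardSuperconductivity-SignStructure"]
def JastrowSlaterShadow : Prop :=
  ∀ U : ℝ, 0 < U → ∀ δ ∈ Set.Ioo (0:ℝ) (1/2), ∃ (N : ℕ → ℕ) (ψ : ∀ L, Literature.MathematicalPhysics.QuantumLattice.Fock (Literature.MathematicalPhysics.QuantumLattice.Orb (Literature.MathematicalPhysics.QuantumLattice.FermionTorus 2 L))), (∀ L, Even L → N L = 2 * ⌊(1 - δ) * (L : ℝ) ^ 2 / 2⌋₊ ∧ star (ψ L) ⬝ᵥ ψ L = 1 ∧ Literature.MathematicalPhysics.QuantumLattice.IsGroundStateInSector (Literature.MathematicalPhysics.QuantumLattice.hubbardTorus 2 L 1 U) (N L) 0 (ψ L)) ∧ ∃ (r : ℕ) (g : Finset (Literature.Probability.LatticeModels.Site 2 × Fin 2) → ℝ), (∀ X, 0 < g X) ∧ ∃ (N' : ℕ → ℕ) (φ : ∀ L, Fin (N' L) → Literature.MathematicalPhysics.QuantumLattice.Orb (Literature.MathematicalPhysics.QuantumLattice.FermionTorus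 2 L) → ℂ), Filter.Tendsto (fun L : ℕ => (Literature.MathematicalPhysics.QuantumLattice.expect ((Literature.MathematicalPhysics.QuantumLattice.pairField Literature.MathematicalPhysics.QuantumLattice.dWaveFormFactor (L + 1))ᴴ * Literature.MathematicalPhysics.QuantumLattice.pairField Literature.MathematicalPhysics.QuantumLattice.dWaveFormFactor (L + 1)) (ψ (L + 1))).re / ((star (ψ (L + 1)) ⬝ᵥ ψ (L + 1)).re * (((L + 1) : ℕ) : ℝ) ^ 4) - (let χ : Literature.MathematicalPhysics.QuantumLattice.Fock (Literature.MathematicalPhysics.QuantumLattice.Orb (Literature.MathematicalPhysics.QuantumLattice.FermionTorus 2 (L + 1))) := fun s => (((fun s : Finset (Literature.MathematicalPhysics.QuantumLattice.Orb (Literature.MathematicalPhysics.QuantumLattice.FermionTorus 2 (L + 1))) => ∏ x : Literature.Probability.LatticeModels.TorusSite 2 (L + 1), g ((Literature.Probability.LatticeModels.box 2 r ×ˢ (Finset.univ : Finset (Fin 2))).filter (fun p => Literature.MathematicalPhysics.QuantumLattice.orb (Literature.MathematicalPhysics.QuantumLattice.FermionTorus.ofTorusSite (x + Literature.Probability.LatticeModels.Torus.proj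 (L + 1) p.1)) p.2 ∈ s))) s : ℝ) : ℂ) * Literature.MathematicalPhysics.QuantumLattice.FirstQuant.slater (fun o : Fin (N' (L + 1)) → Literature.MathematicalPhysics.QuantumLattice.Orb (Literature.MathematicalPhysics.QuantumLattice.FermionTorus 2 (L + 1)) => ∏ k, φ (L + 1) k (o k)) s; (Literature.MathematicalPhysics.QuantumLattice.expect ((Literature.MathematicalPhysics.QuantumLattice.pairField Literature.MathematicalPhysics.QuantumLattice.dWaveFormFactor (L + 1))ᴴ * Literature.MathematicalPhysics.QuantumLattice.pairField Literature.MathematicalPhysics.QuantumLattice.dWaveFormFactor (L + 1)) χ).re / ((star χ ⬝ᵥ χ).re * (((L + 1) : ℕ) : ℝ) ^ 4))) Filter.atTop (nhds 0)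

/-- item stmt-HubbardSuperconductivity-14443 · support · rank 9 · closed · proved by Summit.HubbardSuperconductivity.HubbardSuperconductivity.Theorems.shadowTransfer_proof @ 73b06742a0ba (prover) · by planner
sources: Scalapino1995, FriedliVelenik2017, Yang1962
[support] GLUE cruxes → Target (PROVED, sorry-free, in the planner's SketchProof.lean, lean check rc
0; attached as evidence — a prover ports it into Theorems/ without importing the Theses file,
spelling the three item types out or proving the general bookkeeping lemma and instantiating).
Statement: JastrowSlaterNoDWaveLRO → JastrowSlaterShadow → Target. Proof (12 tactic lines): fix U,
δ; take (N, ψ, admissibility) and the Jastrow–Slater data (r, g, hg, N′, φ) with hT : F_d(ψ_{L+1}) −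
F_d(χ_{L+1}) → 0 from the shadow; the crux at (r, g, hg, N′, φ) is hχ : F_d(χ_{L+1}) → 0 for the
syntactically identical χ-term, so hT.add hχ simplifies (sub_add_cancel) to F_d(ψ_{L+1}) → 0; offer
(N, ψ) as Target's witness; unfold HasLongRangeOrder: the summit's sequence is k ↦ t(2k) with t(L) =
(Σ_{x,y ∈ halfOpenBox 2 L} torusPullback (pairFieldCorr d ψ) L x y)/|halfOpenBox 2 L|²; for k = j+1,
2(j+1) = (2j+1)+1 and torusLROSeq_pairFieldCorr_succ (PairCorrelationsProofs:
sum_halfOpenBox_torusProj, card_halfOpenBox, sum_pairFieldCorr_succ) gives t(2j+2) = Re⟨ψ_{2j+2},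
Δ_d†Δ_d ψ_{2j+2}⟩/(2j+2)⁴ = F_d(ψ_{2j+2}) since Re⟨ψ,ψ⟩ = 1 at even sides; composing with j ↦ 2j+1 →
∞ (tendsto_atTop_mono) the shifted -/
@[route_item "route-HubbardSuperconductivity-SignStructure"]
def ShadowTransfer : Prop :=
  JastrowSlaterNoDWaveLRO → JastrowSlaterShadow → Target

/-- item stmt-HubbardSuperconductivity-2139 · support · rank 9 · open · by planner
sources: BravyiHastingsVerstraete2006, HastingsWen2005, BachLiebSolovej1994, Yang1962
[support] FINITE-DEPTH DRESSING CANNOT PAIR (card S2; provable now, ~1 page of mathematics; Lean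
needs Wick for Slater determinants in the concrete Fock model — valuable infrastructure).
Hypotheses: W_L isometric (hence unitary) on Fock, [W_L, N] = 0, and for every x the conjugated
local d-wave pair operator Q_x = W†P_xW commutes with c_{yσ}, c†_{yσ} whenever torusDist x y > r
(light-cone locality; holds for depth-D circuits of range-R number-conserving gates with r = DR + 1,
and for W = 1 with r ≥ 1). CLAIM: ⟨WΦ_L, Δ_d†Δ_d WΦ_L⟩/(‖Φ_L‖² L⁴) → 0 for every Slater sequence Φ_L
(FirstQuant.slater of product orbitals; 0/0 = 0 if Φ_L = 0). PROOF: Q_x has charge −2 and commutes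
with parity; an even operator commuting with all outside odd generators lies in CAR(B_r(x))_even
(graded bicommutant on a finite set); expand Q_x in ≤ 16^{|B|} monomials with coefficients ≤ ‖P_x‖;
Wick in the quasi-free pure state Φ/‖Φ‖ (G = projector onto the orbital span); for disjoint balls
charge counting forces ≥ 2 contractions crossing B_x → B_y, each a matrix element ±G(a,b);
|G(a,b)G(a′,b′)| ≤ (|G(a,b)|² + |G(a′,b′)|²)/2 and Σ_b |G(a,b)|² = (G²)(a,a) = G(a,a) ≤ 1, each b
lying in ≤ |B| balls; overlapping b -/
@[route_item "route-HubbardSuperconductivity-SignStructure"]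
def DressedSlaterNoPairLRO : Prop :=
  ∀ (r : ℕ) (N : ℕ → ℕ) (φ : ∀ L, Fin (N L) → Literature.MathematicalPhysics.QuantumLattice.Orb (Literature.MathematicalPhysics.QuantumLattice.FermionTorus 2 L) → ℂ) (W : ∀ L, Matrix (Finset (Literature.MathematicalPhysics.QuantumLattice.Orb (Literature.MathematicalPhysics.QuantumLattice.FermionTorus 2 L))) (Finset (Literature.MathematicalPhysics.QuantumLattice.Orb (Literature.MathematicalPhysics.QuantumLattice.FermionTorus 2 L))) ℂ), (∀ L, (W L)ᴴ * W L = 1 ∧ Commute (W L) Literature.MathematicalPhysics.QuantumLattice.totalNumber) → (∀ (L : ℕ) [NeZero L] (x y : Literature.Probability.LatticeModels.TorusSite 2 L) (σ : Fin 2), r < Literature.MathematicalPhysics.QuantumLattice.torusDist x y → Commute ((W L)ᴴ * Literature.MathematicalPhysics.QuantumLattice.localPair Literature.MathematicalPhysics.QuantumLattice.dWaveFormFactor L x * W L) (Literature.MathematicalPhysics.QuantumLattice.annihilation (Literature.MathematicalPhysics.QuantumLattice.orb (Literature.MathematicalPhysics.QuantumLattice.FermionTorus.ofTorusSite y) σ))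 ∧ Commute ((W L)ᴴ * Literature.MathematicalPhysics.QuantumLattice.localPair Literature.MathematicalPhysics.QuantumLattice.dWaveFormFactor L x * W L) (Literature.MathematicalPhysics.QuantumLattice.creation (Literature.MathematicalPhysics.QuantumLattice.orb (Literature.MathematicalPhysics.QuantumLattice.FermionTorus.ofTorusSite y) σ))) → Filter.Tendsto (fun L : ℕ => let χ : Literature.MathematicalPhysics.QuantumLattice.Fock (Literature.MathematicalPhysics.QuantumLattice.Orb (Literature.MathematicalPhysics.QuantumLattice.FermionTorus 2 (L + 1))) := W (L + 1) *ᵥ Literature.MathematicalPhysics.QuantumLattice.FirstQuant.slater (fun o : Fin (N (L + 1)) → Literature.MathematicalPhysics.QuantumLattice.Orb (Literature.MathematicalPhysics.QuantumLattice.FermionTorus 2 (L + 1)) => ∏ k, φ (L + 1) k (o k)); (Literature.MathematicalPhysics.QuantumLattice.expect ((Literature.MathematicalPhysics.QuantumLattice.pairField Literature.MathematicalPhysics.QuantumLattice.dWaveFormFactor (L + 1))ᴴ * Literature.MathematicalPhysics.QuantumLattice.pairField Literature.MathematicalPhysics.QuantumLattice.dWaveFormFactor (L + 1)) χ).re / ((star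 χ ⬝ᵥ χ).re * (((L + 1) : ℕ) : ℝ) ^ 4)) Filter.atTop (nhds 0)

/-- item stmt-HubbardSuperconductivity-2140 · support · rank 9 · closed · proved by Summit.HubbardSuperconductivity.HubbardSuperconductivity.Theorems.SignStructure.slaterRankBound_proof @ 89bb95c7c1bb (prover) · by planner
sources: Yang1962, YangODLRO1962, Coleman1965, BachLiebSolovej1994
[support] SLATER RANK (card S1; provable now). For ψ = Σ_{a<m} α_a Φ_a with Φ_a = FirstQuant.slater
of product orbitals (unnormalised, not necessarily orthogonal, any finite ordered orbital type ι):
Re v†ρ₂(ψ)v = ‖P_v ψ‖² ≤ (Σ_a |α_a| ‖P_vΦ_a‖)² ≤ 2(Σ_a |α_a|‖Φ_a‖)²‖v‖², using Yang's identity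
⟨P_v†P_v⟩ = v†ρ₂v (named fact expect_pairAnnihilator_conjTranspose_mul) and λ_max(ρ₂(Slater)) = 2
(ρ₂ = (1 − Ex)(γ ⊗ γ), γ the projector onto the orbital span; eigenvalue 2 on antisymmetric pair
functions in occ ⊗ occ). COROLLARY (bookkeeping, not filed): for orthonormal Φ_a and ‖ψ‖ = 1,
Σ|α_a|² = 1 ⇒ λ_max(ρ₂(ψ)) ≤ 2m, so Yang ODLRO λ_max ≥ cN (implied by the summit's pair-field LRO
via ⟨Δ_d†Δ_d⟩ = φ_d†ρ₂φ_d, ‖φ_d‖² = 4L²) forces Slater rank m ≥ cN/2: a condensate is a coherent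
superposition of ≳ N mean-field configurations (pairing is entirely off-diagonal in the
Hubbard–Stratonovich field). Calibration item; also usable by YangSpectral. || Sources: Yang1962,
Coleman1965, BachLiebSolovej1994. -/
@[route_item "route-HubbardSuperconductivity-SignStructure"]
def SlaterRankBound : Prop :=
  ∀ (ι : Type) [LinearOrder ι] [Fintype ι] (m N : ℕ) (α : Fin m → ℂ) (φ : Fin m → Fin N → ι → ℂ) (v : ι × ι → ℂ), (star v ⬝ᵥ (Literature.MathematicalPhysics.QuantumLattice.twoParticleRDM (∑ a, α a • Literature.MathematicalPhysics.QuantumLattice.FirstQuant.slater (fun o : Fin N → ι => ∏ k, φ a k (o k))) *ᵥ v)).re ≤ 2 * (∑ a, ‖α a‖ * Real.sqrt ((star (Literature.MathematicalPhysics.QuantumLattice.FirstQuant.slater (fun o : Fin N → ι => ∏ k, φ a k (o k))) ⬝ᵥ Literature.MathematicalPhysics.QuantumLattice.FirstQuant.slater (fun o : Fin N → ι => ∏ k, φ a k (o k))).re)) ^ 2 * (star v ⬝ᵥ v).re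

/-- item stmt-HubbardSuperconductivity-2141 · support · rank 9 · open · by planner
sources: QinEtAl2020, XuEtAl2024, Sorella2023, MaierEtAl2005, ArovasBergKivelsonRaghu2022, Literature.Barriers.HubbardSuperconductivity.PureModelStripeCompetition
[support] THE BRIDGE (membership bet; regional, numerics-anchored, tool-less — filed so that the
logical skeleton crux → regional Target is explicit; NOT a crux). JastrowSlaterNoDWaveLRO → Target
restricted to U ∈ [6,8], δ ∈ [1/10,1/6] (the window of NoGo.NogoStripeWindow, whose consequent this
is, in audited typing). Content behind the implication: at t' = 0, U ≈ 6–8, δ ≈ 1/8 some (N_L,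
S^z=0)-sector ground-state sequence is d-wave-pair-correlator-equivalent (Σ_{x,y}|difference| =
o(L⁴)) to a fixed-weight Jastrow × (UHF filled-stripe) Slater sequence; evidence: DMRG +
constrained-path AFQMC with UHF-stripe trial states find filled stripes and decaying pair
correlations (QinEtAl2020 pp.1–2, 9), SC only with t' ≠ 0 (XuEtAl2024); contested (MaierEtAl2005 DCA
d-wave; Sorella2023; ABKR2022 §8.1 'presently unsettled'). Why it might fail: the stripe GS may
carry weak d-wave/PDW pairing beyond any Jastrow–Slater description; no rigorous tool at U = O(8t).
Beyond this window the membership step is consensus-false (weak coupling: Kohn–Luttinger) and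
deliberately unfiled. || Sources: QinEtAl2020, XuEtAl2024, Sorella2023, MaierEtAl2005. -/
@[route_item "route-HubbardSuperconductivity-SignStructure"]
def StripeWindowMembership : Prop :=
  JastrowSlaterNoDWaveLRO → ∀ U ∈ Set.Icc (6:ℝ) 8, ∀ δ ∈ Set.Icc (1/10:ℝ) (1/6), ∃ (N : ℕ → ℕ) (ψ : ∀ L, Literature.MathematicalPhysics.QuantumLattice.Fock (Literature.MathematicalPhysics.QuantumLattice.Orb (Literature.MathematicalPhysics.QuantumLattice.FermionTorus 2 L))), (∀ L, Even L → N L = 2 * ⌊(1 - δ) * (L : ℝ) ^ 2 / 2⌋₊ ∧ star (ψ L) ⬝ᵥ ψ L = 1 ∧ Literature.MathematicalPhysics.QuantumLattice.IsGroundStateInSector (Literature.MathematicalPhysics.QuantumLattice.hubbardTorus 2 L 1 U) (N L) 0 (ψ L)) ∧ ¬ Literature.Probability.LatticeModels.HasLongRangeOrder (fun k => Literature.Probability.LatticeModels.halfOpenBox 2 (2 * k)) (fun k => Literature.MathematicalPhysics.QuantumLattice.torusPullback (Literature.MathematicalPhysics.QuantumLattice.pairFieldCorr Literature.MathematicalPhysics.QuantumLattice.dWaveFormFactor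 ψ) (2 * k))

/-- item stmt-HubbardSuperconductivity-2142 · assembly · rank 1 · closed · proved by Summit.HubbardSuperconductivity.HubbardSuperconductivity.Theorems.signStructure_assembly_proof (prover) · by planner
sources: Scalapino1995
[assembly] Pure logic (planner sketch rc0: `intro hT hS; obtain ⟨U,hU,δ,hδ,h⟩ :=
HubbardSuperconductivity_iff.mp hS; obtain ⟨N,ψ,hyp,hn⟩ := hT U hU δ hδ; exact hn (h N ψ hyp)`). The
cruxes feed Target only through membership statements (StripeWindowMembership regionally; unfiled
elsewhere) — see the CANDOUR paragraph of the thesis. -/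
@[route_item "route-HubbardSuperconductivity-SignStructure"]
def Assembly : Prop :=
  Target → ¬ HubbardSuperconductivity

/-! D-0027 §2.1 — DECIDING THEOREM (planner-authored via `route open/edit --closes-file`; by planner-rbadge-HubbardSuperconductivity-SignSt-3dfc49d8-g2-0 2026-08-15T16:17:25Z):
its hypotheses are this route's items and its conclusion the sub-problem Statement (glue_lint), and it elaborates with this file. -/

@[closes "route-HubbardSuperconductivity-SignStructure"] theorem closes (hT : Target) : ¬ _root_.HubbardSuperconductivity := by
  intro hS
  obtain ⟨U, hU, δ, hδ, h⟩ := (_root_.HubbardSuperconductivity_iff).mp hS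
  obtain ⟨N, ψ, hyp, hn⟩ := hT U hU δ hδ
  exact hn (h N ψ hyp)

end Summit.HubbardSuperconductivity.HubbardSuperconductivity.Theses.SignStructure
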